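import Mathlib
import Summits.NavierStokesRegularity.NavierStokesRegularity.Theorems.EulerZoomLiouvillePowerGaugeEulerLiouvilleCondenserInfiniteType
import Summits.NavierStokesRegularity.NavierStokesRegularity.Theorems.EulerZoomLiouvillePowerGaugeEulerLiouvilleCondenserWindowSummability
import Summits.NavierStokesRegularity.NavierStokesRegularity.Theorems.EulerZoomLiouvillePowerGaugeEulerLiouvilleCondenserWindowSummation
import Summits.NavierStokesRegularity.NavierStokesRegularity.Theorems.EulerZoomLiouvillePowerGaugeEulerLiouvilleSelfSimilarBernoulliPiercing
import Summits.NavierStokesRegularity.NavierStokesRegularity.Theorems.EulerZoomLiouvillePowerGaugeEulerLiouvilleEnergySaturationMember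
import Summits.NavierStokesRegularity.NavierStokesRegularity.Theorems.EulerZoomLiouvillePowerGaugeEulerLiouvilleNeedleThinCoreMember
import Summits.NavierStokesRegularity.NavierStokesRegularity.Theorems.EulerZoomLiouvillePowerGaugeEulerLiouvilleLastExitCriticalSpikes
import Summits.NavierStokesRegularity.NavierStokesRegularity.Theorems.EulerZoomLiouvillePowerGaugeEulerLiouvilleWeakIntegrableVorticity

/-!
# NEEDLE DIGEST — the registered portrait of THE ONE STATEMENT as POSITIVE properties of a hypothetical nontrivial member (LEAD 19832 g14)

Helper file for crux `EulerZoomLiouville.PowerGaugeEulerLiouville` (stmt-NavierStokesRegularity-19832), LEAD ns-typeII-p2 g14, `--supports … --as helper`.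
The census of the `C²` needle (`Sig.stub_selfSimilarC2Needle` of `Cruxes/PowerGaugeEulerLiouville/Lines/birth.lean`) is registered as NEGATED BINDERS («every member of
class X is trivial»).  Refuters, ideators and the compute seat of T-K (RESIDUE-MEMO-19832-g14 §9–§11) need the CONTRAPOSITIVES: what a NONTRIVIAL exactly self-similar
`C²` member would have to look like.  This file states three of them by name, each a few lines over the landed member (no new analysis):

* `NeedleDigest.gradient_type_unbounded` — (N7)∞: for every `C` and `R₀` some `R ≥ R₀` and `z ∈ B(0,3R)` with `‖DV(z)‖ > exp(C R^{2+ρ})`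
  [contrapositive of `Condenser.selfSimilar_ae_eq_zero_of_finiteTypeGradientC2`, p684185];
* `NeedleDigest.window_type_summable` — the E-line's ceiling: along every separated `q`-adic window family with envelopes `exp(G_k)` on `B(0,qℓ_k)`,
  `Σ_k ℓ_k^{2+ρ}/G_k < ∞` [contrapositive of K^Σ′ `Condenser.selfSimilar_ae_eq_zero_of_windowDivergentC2_of` (ns-sfl-p1 g7) over the plates
  `Condenser.weightedWindowBudget` / `Condenser.windowSummation` (ns-ezl-w2 g5); the class constant `c = 0` case is sub-extremal];
* `NeedleDigest.vortical_high_inflow_on_spheres` — (N1): for some classical pressure `P′`, level `h` and radius `R₀`, EVERY sphere `‖y‖ = R ≥ R₀` carries a point with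
  `⟪y, V y⟫ ≤ −γ‖y‖²` (inflow at the similarity rate), `curl V y ≠ 0` and `ℋ_{P′}(y) ≥ h` [contrapositive of `Loc.selfSimilar_ae_eq_zero_of_piercingBernoulliC2_profile`, LEAD g11].
* `NeedleDigest.curl_not_integrable_and_memLp_two` / `lintegral_curl_eq_top_or` (LEAD g15, after W-IV) — (N-ω), `ρ < ½`: `¬ (Integrable (curl V) ∧ MemLp (curl V) 2)`,
  i.e. `∫⁻‖curl V‖ₑ = ∞ ∨ ∫⁻‖curl V‖ₑ² = ∞` [contrapositive of `WeakConfinedVorticity.selfSimilar_ae_eq_zero_of_integrableCurl_profile`, ns-ezl-w1 g8, at `G = DV`].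

WHAT THIS IS NOT: not NS, not E — portrait statements about HYPOTHETICAL nontrivial members (if the crux holds there are none); nothing here proves or refutes the crux;
19832 OPEN; NS regularity NOT proved. [folklore (contraposition); ConstantinIgnatovaVicol2026Putative §3.4–§3.5 for the setting]
-/

noncomputable section

open Set Filter Topology Metric Function MeasureTheory Real
open scoped RealInnerProductSpace NNReal ENNReal

set_option linter.dupNamespace false

namespace Summit.NavierStokesRegularity.NavierStokesRegularity.Theorems.PowerGaugeEulerLiouville.NeedleDigest

open Literature.Analysis Literature.Analysis.FluidPDE
open Summit.NavierStokesRegularity.NavierStokesRegularity.Theorems.PowerGaugeEulerLiouville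

variable {ρ : ℝ} {u : ℝ → EuclideanSpace ℝ (Fin 3) → EuclideanSpace ℝ (Fin 3)} {p : ℝ → EuclideanSpace ℝ (Fin 3) → ℝ}
  {H : ℝ → EuclideanSpace ℝ (Fin 3) → EuclideanSpace ℝ (Fin 3) →L[ℝ] EuclideanSpace ℝ (Fin 3)} {c : ℝ≥0}
  {V : EuclideanSpace ℝ (Fin 3) → EuclideanSpace ℝ (Fin 3)} {P : EuclideanSpace ℝ (Fin 3) → ℝ}

/-- **(N7)∞ — A NONTRIVIAL `C²` NEEDLE HAS UNBOUNDED GRADIENT TYPE AT THE CLOCK ORDER.**  Crux binders verbatim, `0 < ρ ≤ ½`, exact self-similarity about the origin, `V ∈ C²`,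
and the member NOT a.e. zero ⇒ for every `C` and `R₀` there are `R ≥ R₀` and `z ∈ B(0,3R)` with `exp(C R^{2+ρ}) < ‖DV(z)‖`.  Contrapositive of p684185.
[folklore; ConstantinIgnatovaVicol2026Putative §3.4.1] -/
theorem gradient_type_unbounded (hρ : 0 < ρ) (hρ1 : ρ ≤ 1 / 2)
    (hsw : IsSuitableWeakSolutionOn (slab (EuclideanSpace ℝ (Fin 3)) (Iio 0) isOpen_Iio) 0 0 u p)
    (hH : HasWeakSpatialGradientOn (slab (EuclideanSpace ℝ (Fin 3)) (Iio 0) isOpen_Iio) u H)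
    (hgauge : ∀ a : ℝ, 0 < a →
      ENNReal.ofReal (a ^ (2 * ρ)) * cknA a (0 : ℝ × EuclideanSpace ℝ (Fin 3)) u +
          ENNReal.ofReal (a ^ ρ) * cknE a (0 : ℝ × EuclideanSpace ℝ (Fin 3)) H +
        ENNReal.ofReal (a ^ (2 * ρ)) * cknD a (0 : ℝ × EuclideanSpace ℝ (Fin 3)) p ≤ (c : ℝ≥0∞))
    (hu : ∀ τ : ℝ, τ < 0 → u τ = selfSimilarCollapse (1 / (2 + ρ)) 0 V τ)
    (hp : ∀ τ : ℝ, τ < 0 → p τ = selfSimilarCollapsePressure (1 / (2 + ρ)) 0 P τ)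
    (hV : ContDiff ℝ 2 V)
    (hnt : ¬ (uncurry u =ᵐ[volume.restrict (Iio (0 : ℝ) ×ˢ (univ : Set (EuclideanSpace ℝ (Fin 3))))] 0)) :
    ∀ C R₀ : ℝ, ∃ R : ℝ, R₀ ≤ R ∧
      ∃ z ∈ ball (0 : EuclideanSpace ℝ (Fin 3)) (3 * R), Real.exp (C * R ^ (2 + ρ)) < ‖fderiv ℝ V z‖ := by
  by_contra h
  push Not at h
  obtain ⟨C, R₀, hCR⟩ := h
  refine hnt (Condenser.selfSimilar_ae_eq_zero_of_finiteTypeGradientC2 hρ hρ1 hsw hH hgauge hu hp hV ⟨C, fun R₁ => ?_⟩)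
  exact ⟨max R₀ R₁, le_max_right _ _, fun z hz => hCR (max R₀ R₁) (le_max_left _ _) z hz⟩

/-- **THE E-LINE'S CEILING — A NONTRIVIAL `C²` NEEDLE HAS SUMMABLE WINDOW-TYPE RECIPROCALS.**  Crux binders verbatim, `V ∈ C²`, member NOT a.e. zero; for every `q > 1`,
every separated window family (`0 < ℓ_k`, `qℓ_k ≤ ℓ_{k+1}`) and every envelopes `‖DV‖ ≤ exp(G_k)` on `B(0,qℓ_k)` with `G_k ≥ 1`: `Σ_k ℓ_k^{2+ρ}/G_k` CONVERGES.  Contrapositive of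
K^Σ′ (nsreg-p2 ROUND-47 §5b; ns-sfl-p1 g7's `Condenser.selfSimilar_ae_eq_zero_of_windowDivergentC2_of` over ns-ezl-w2 g5's plates); a member with class constant `c = 0` is
sub-extremal, hence trivial (`EnergySaturation.selfSimilar_ae_eq_zero_of_subExtremal`). [folklore; ConstantinIgnatovaVicol2026Putative §3.4.1] -/
theorem window_type_summable (hρ : 0 < ρ) (hρ1 : ρ ≤ 1 / 2)
    (hsw : IsSuitableWeakSolutionOn (slab (EuclideanSpace ℝ (Fin 3)) (Iio 0) isOpen_Iio) 0 0 u p)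
    (hH : HasWeakSpatialGradientOn (slab (EuclideanSpace ℝ (Fin 3)) (Iio 0) isOpen_Iio) u H)
    (hgauge : ∀ a : ℝ, 0 < a →
      ENNReal.ofReal (a ^ (2 * ρ)) * cknA a (0 : ℝ × EuclideanSpace ℝ (Fin 3)) u +
          ENNReal.ofReal (a ^ ρ) * cknE a (0 : ℝ × EuclideanSpace ℝ (Fin 3)) H +
        ENNReal.ofReal (a ^ (2 * ρ)) * cknD a (0 : ℝ × EuclideanSpace ℝ (Fin 3)) p ≤ (c : ℝ≥0∞))
    (hu : ∀ τ : ℝ, τ < 0 → u τ = selfSimilarCollapse (1 / (2 + ρ)) 0 V τ)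
    (hp : ∀ τ : ℝ, τ < 0 → p τ = selfSimilarCollapsePressure (1 / (2 + ρ)) 0 P τ)
    (hV : ContDiff ℝ 2 V)
    (hnt : ¬ (uncurry u =ᵐ[volume.restrict (Iio (0 : ℝ) ×ˢ (univ : Set (EuclideanSpace ℝ (Fin 3))))] 0))
    {q : ℝ} {ℓ G : ℕ → ℝ} (hq : 1 < q) (hℓpos : ∀ k : ℕ, 0 < ℓ k) (hsep : ∀ k : ℕ, q * ℓ k ≤ ℓ (k + 1))
    (hG1 : ∀ k : ℕ, 1 ≤ G k)
    (henv : ∀ k : ℕ, ∀ z ∈ ball (0 : EuclideanSpace ℝ (Fin 3)) (q * ℓ k), ‖fderiv ℝ V z‖ ≤ Real.exp (G k)) :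
    Summable (fun k : ℕ => ℓ k ^ (2 + ρ) / G k) := by
  by_contra hdiv
  apply hnt
  by_cases hc0 : (0 : ℝ) < (c : ℝ)
  · exact Condenser.selfSimilar_ae_eq_zero_of_windowDivergentC2_of Condenser.weightedWindowBudget Condenser.windowSummation
      hρ hρ1 hc0 hsw hH hgauge hu hp hV hq hℓpos hsep hG1 henv hdiv
  · -- `c = 0`: the A-budget vanishes, the member is sub-extremal
    have hc' : (c : ℝ≥0∞) = 0 := by
      have : (c : ℝ) = 0 := le_antisymm (not_lt.1 hc0) c.2
      exact_mod_cast this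
    refine EnergySaturation.selfSimilar_ae_eq_zero_of_subExtremal hρ (by linarith) hsw hH hgauge hu hp ?_
    intro ε hε L₀
    obtain ⟨hA', -⟩ :=
      NeedleThinCore.selfSimilar_needle_inputs hρ (by linarith) hsw hH hgauge hu hp (hV.of_le one_le_two)
    refine ⟨max L₀ 1, le_max_left _ _, ?_⟩
    have hL : (0 : ℝ) < max L₀ 1 := lt_of_lt_of_le one_pos (le_max_right _ _)
    have h0 : ∫ y in ball (0 : EuclideanSpace ℝ (Fin 3)) (max L₀ 1), ‖V y‖ ^ 2 ≤ 0 :=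
      Condenser.setIntegral_sq_le_of_lintegral hV.continuous le_rfl
        ((hA' _ hL).trans (by rw [hc', zero_mul, ENNReal.ofReal_zero]))
    have h1 : 0 ≤ (max L₀ 1) ^ (2 * ρ - 1) := Real.rpow_nonneg hL.le _
    nlinarith [mul_le_mul_of_nonneg_left h0 h1]

/-- **(N1) — A NONTRIVIAL `C²` NEEDLE HAS A VORTICAL, BERNOULLI-HIGH INFLOW POINT ON EVERY LARGE SPHERE.**  Crux binders verbatim, `V ∈ C²`, member NOT a.e. zero ⇒ for
some classical pressure `P′` of the profile, some level `h` and radius `R₀`: every sphere `‖y‖ = R`, `R ≥ R₀`, carries a point `y` with `⟪y, V y⟫ ≤ −‖y‖²/(2+ρ)` (so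
`‖V(y)‖ ≥ γ‖y‖`: the needle's fast spine), `curl V y ≠ 0` and `ℋ_{P′}(y) ≥ h`.  Contrapositive of `Loc.selfSimilar_ae_eq_zero_of_piercingBernoulliC2_profile` (LEAD g11).
[folklore; ConstantinIgnatovaVicol2026Putative §3.4–§3.5] -/
theorem vortical_high_inflow_on_spheres (hρ : 0 < ρ) (hρ1 : ρ ≤ 1 / 2)
    (hsw : IsSuitableWeakSolutionOn (slab (EuclideanSpace ℝ (Fin 3)) (Iio 0) isOpen_Iio) 0 0 u p)
    (hgauge : ∀ a : ℝ, 0 < a →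
      ENNReal.ofReal (a ^ (2 * ρ)) * cknA a (0 : ℝ × EuclideanSpace ℝ (Fin 3)) u +
          ENNReal.ofReal (a ^ ρ) * cknE a (0 : ℝ × EuclideanSpace ℝ (Fin 3)) H +
        ENNReal.ofReal (a ^ (2 * ρ)) * cknD a (0 : ℝ × EuclideanSpace ℝ (Fin 3)) p ≤ (c : ℝ≥0∞))
    (hu : ∀ τ : ℝ, τ < 0 → u τ = selfSimilarCollapse (1 / (2 + ρ)) 0 V τ)
    (hp : ∀ τ : ℝ, τ < 0 → p τ = selfSimilarCollapsePressure (1 / (2 + ρ)) 0 P τ)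
    (hV : ContDiff ℝ 2 V)
    (hnt : ¬ (uncurry u =ᵐ[volume.restrict (Iio (0 : ℝ) ×ˢ (univ : Set (EuclideanSpace ℝ (Fin 3))))] 0)) :
    ∃ P' : EuclideanSpace ℝ (Fin 3) → ℝ, IsSelfSimilarEulerProfile (1 / (2 + ρ)) 0 V P' ∧
      ∃ h R₀ : ℝ, ∀ R : ℝ, R₀ ≤ R → ∃ y : EuclideanSpace ℝ (Fin 3), ‖y‖ = R ∧
        ⟪y, V y⟫ ≤ -(1 / (2 + ρ) * ‖y‖ ^ 2) ∧ curl V y ≠ 0 ∧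
        h ≤ selfSimilarBernoulli (1 / (2 + ρ)) 0 V P' y := by
  by_contra h
  push Not at h
  refine hnt (Loc.selfSimilar_ae_eq_zero_of_piercingBernoulliC2_profile hρ hρ1 hsw hgauge hu hp hV ?_)
  intro P' hprof h₀ R₀
  obtain ⟨R, hR, hy⟩ := h P' hprof h₀ R₀
  refine ⟨R, hR, fun y hyR hin => ?_⟩
  by_cases hc : curl V y = 0
  · exact Or.inl hc
  · exact Or.inr (hy y hyR hin hc)

/-- **(N-SPIKE) — A NONTRIVIAL `C²` NEEDLE HOVERS FAR OUT OR CARRIES CRITICAL-ORDER BERNOULLI SPIKES WITH AN EXPLICIT FLOOR** (appended by LEAD g14 after K-SPIKE,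
ns-sfl-p1 g7 p686203, wired v98 as `IsKinematicTameProfile` alt 7).  Crux binders verbatim, `V ∈ C²`, member NOT a.e. zero ⇒ for some classical pressure `P′` of the profile:
for EVERY vortical point `x₀`, EVERY level `h < ℋ(x₀)`, EVERY hovering floor `w₀ > 0` and radius `R₁`: EITHER some vortical point `y` of `{ℋ > h}` with `‖y‖ ≥ R₁` hovers
(`‖W y‖ < w₀`), OR for EVERY `C < κ_sp(ρ,c,w₀) = (1−2γ)w₀²β₀/(24γ)` there are `R ≥ 1` and a vortical `z ∈ B̄(0,2R)` with `ℋ(z) > h + C R^{2+ρ}` (critical-order spikes with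
floor κ_sp; `β₀` the explicit thin-exit rate).  Contrapositive of `Loc.selfSimilar_ae_eq_zero_of_criticalSpikesC2_profile`. [folklore; ConstantinIgnatovaVicol2026Putative §3.4–§3.5] -/
theorem hovering_or_critical_spikes (hρ : 0 < ρ) (hρ1 : ρ ≤ 1 / 2)
    (hsw : IsSuitableWeakSolutionOn (slab (EuclideanSpace ℝ (Fin 3)) (Iio 0) isOpen_Iio) 0 0 u p)
    (hH : HasWeakSpatialGradientOn (slab (EuclideanSpace ℝ (Fin 3)) (Iio 0) isOpen_Iio) u H)
    (hgauge : ∀ a : ℝ, 0 < a →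
      ENNReal.ofReal (a ^ (2 * ρ)) * cknA a (0 : ℝ × EuclideanSpace ℝ (Fin 3)) u +
          ENNReal.ofReal (a ^ ρ) * cknE a (0 : ℝ × EuclideanSpace ℝ (Fin 3)) H +
        ENNReal.ofReal (a ^ (2 * ρ)) * cknD a (0 : ℝ × EuclideanSpace ℝ (Fin 3)) p ≤ (c : ℝ≥0∞))
    (hu : ∀ τ : ℝ, τ < 0 → u τ = selfSimilarCollapse (1 / (2 + ρ)) 0 V τ)
    (hp : ∀ τ : ℝ, τ < 0 → p τ = selfSimilarCollapsePressure (1 / (2 + ρ)) 0 P τ)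
    (hV : ContDiff ℝ 2 V)
    (hnt : ¬ (uncurry u =ᵐ[volume.restrict (Iio (0 : ℝ) ×ˢ (univ : Set (EuclideanSpace ℝ (Fin 3))))] 0)) :
    ∃ P' : EuclideanSpace ℝ (Fin 3) → ℝ, IsSelfSimilarEulerProfile (1 / (2 + ρ)) 0 V P' ∧
      ∀ x₀ : EuclideanSpace ℝ (Fin 3), curl V x₀ ≠ 0 → ∀ h : ℝ, h < selfSimilarBernoulli (1 / (2 + ρ)) 0 V P' x₀ →
        ∀ w₀ R₁ : ℝ, 0 < w₀ →
          (∃ y : EuclideanSpace ℝ (Fin 3), R₁ ≤ ‖y‖ ∧ h < selfSimilarBernoulli (1 / (2 + ρ)) 0 V P' y ∧ curl V y ≠ 0 ∧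
              ‖selfSimilarTransport (1 / (2 + ρ)) 0 V y‖ < w₀) ∨
          ∀ C : ℝ, C < (1 - 2 * (1 / (2 + ρ))) * w₀ ^ 2 * (min 1 ((1 / (2 + ρ)) ^ 2 / (614400 * (NeedleBandLaw.bandConst + 1) *
              (2 * ((c : ℝ) * 2 ^ (1 - 2 * ρ)) + 2 * ((1 - ρ) / (2 + ρ) * (c : ℝ)) + 2))) / 4) / (24 * (1 / (2 + ρ))) →
            ∃ R : ℝ, 1 ≤ R ∧ ∃ z : EuclideanSpace ℝ (Fin 3), ‖z‖ ≤ 2 * R ∧ curl V z ≠ 0 ∧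
              h < selfSimilarBernoulli (1 / (2 + ρ)) 0 V P' z ∧ h + C * R ^ (2 + ρ) < selfSimilarBernoulli (1 / (2 + ρ)) 0 V P' z := by
  by_contra hneg
  push Not at hneg
  refine hnt (Loc.selfSimilar_ae_eq_zero_of_criticalSpikesC2_profile hρ hρ1 hsw hH hgauge hu hp hV ?_)
  intro P' hprof
  obtain ⟨x₀, hx₀, h, hh, w₀, R₁, hw₀, hhov, C, hC, henv⟩ := hneg P' hprof
  exact ⟨x₀, hx₀, h, hh, w₀, R₁, hw₀, fun y hy hhy hcy => hhov y hy hhy hcy, C, hC,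
    fun R hR z hz hcz hhz => henv R hR z hz hcz hhz⟩

/-- **(N-ω) — A NONTRIVIAL NEEDLE HAS NON-INTEGRABLE VORTICITY** (appended by LEAD g15 after W-IV «integrable vorticity», ns-ezl-w1 g8 p692391, wired v103 as
`IsWeakConfinedCurl` alternative 3; THE ONE STATEMENT carries `¬ IsWeakConfinedCurl ρ V` since v102).  Crux binders verbatim, `0 < ρ < ½`, `V ∈ C¹` (in particular the `C²`
needle), member NOT a.e. zero ⇒ `¬ (Integrable (curl V) ∧ MemLp (curl V) 2)`: the profile's vorticity has infinite total mass `∫‖curl V‖ = ∞` or infinite enstrophy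
`∫‖curl V‖² = ∞` (compare the E-gauge ceiling `∫_{B_L}‖DV‖² ≲ c L^{1−ρ}` and its o-form p684185).  Contrapositive of
`WeakConfinedVorticity.selfSimilar_ae_eq_zero_of_integrableCurl_profile` at `G = fderiv ℝ V` (`HasWeakFDerivOn.of_contDiff_holds`; `curl V y = curlCLM (fderiv ℝ V y)` is `rfl`).
[folklore; ChaeShvydkoy2013 §4 Thm 4.1] -/
theorem curl_not_integrable_and_memLp_two (hρ : 0 < ρ) (hρ2 : ρ < 1 / 2)
    (hsw : IsSuitableWeakSolutionOn (slab (EuclideanSpace ℝ (Fin 3)) (Iio 0) isOpen_Iio) 0 0 u p)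
    (hH : HasWeakSpatialGradientOn (slab (EuclideanSpace ℝ (Fin 3)) (Iio 0) isOpen_Iio) u H)
    (hgauge : ∀ a : ℝ, 0 < a →
      ENNReal.ofReal (a ^ (2 * ρ)) * cknA a (0 : ℝ × EuclideanSpace ℝ (Fin 3)) u +
          ENNReal.ofReal (a ^ ρ) * cknE a (0 : ℝ × EuclideanSpace ℝ (Fin 3)) H +
        ENNReal.ofReal (a ^ (2 * ρ)) * cknD a (0 : ℝ × EuclideanSpace ℝ (Fin 3)) p ≤ (c : ℝ≥0∞))
    (hu : ∀ τ : ℝ, τ < 0 → u τ = selfSimilarCollapse (1 / (2 + ρ)) 0 V τ)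
    (hp : ∀ τ : ℝ, τ < 0 → p τ = selfSimilarCollapsePressure (1 / (2 + ρ)) 0 P τ)
    (hV : ContDiff ℝ 1 V)
    (hnt : ¬ (uncurry u =ᵐ[volume.restrict (Iio (0 : ℝ) ×ˢ (univ : Set (EuclideanSpace ℝ (Fin 3))))] 0)) :
    ¬ (Integrable (curl V) volume ∧ MemLp (curl V) 2 volume) := by
  rintro ⟨h1, h2⟩
  have hVG : FunctionSpaces.HasWeakFDerivOn (⊤ : TopologicalSpace.Opens (EuclideanSpace ℝ (Fin 3))) volume V (fderiv ℝ V) :=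
    FunctionSpaces.HasWeakFDerivOn.of_contDiff_holds ⊤ volume hV
  exact hnt (WeakConfinedVorticity.selfSimilar_ae_eq_zero_of_integrableCurl_profile hρ hρ2 hsw hH hgauge hu hp hVG h1 h2)

/-- **(N-ω), extended-integral form**: under the same hypotheses, `∫⁻ ‖curl V‖ₑ = ∞` or `∫⁻ ‖curl V‖ₑ² = ∞` — a nontrivial needle's far vortical cells carry INFINITE total
vorticity or INFINITE enstrophy (`curl V` is continuous, so integrability is only a question of size). [folklore; ChaeShvydkoy2013 §4 Thm 4.1] -/
theorem lintegral_curl_eq_top_or (hρ : 0 < ρ) (hρ2 : ρ < 1 / 2)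
    (hsw : IsSuitableWeakSolutionOn (slab (EuclideanSpace ℝ (Fin 3)) (Iio 0) isOpen_Iio) 0 0 u p)
    (hH : HasWeakSpatialGradientOn (slab (EuclideanSpace ℝ (Fin 3)) (Iio 0) isOpen_Iio) u H)
    (hgauge : ∀ a : ℝ, 0 < a →
      ENNReal.ofReal (a ^ (2 * ρ)) * cknA a (0 : ℝ × EuclideanSpace ℝ (Fin 3)) u +
          ENNReal.ofReal (a ^ ρ) * cknE a (0 : ℝ × EuclideanSpace ℝ (Fin 3)) H +
        ENNReal.ofReal (a ^ (2 * ρ)) * cknD a (0 : ℝ × EuclideanSpace ℝ (Fin 3)) p ≤ (c : ℝ≥0∞))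
    (hu : ∀ τ : ℝ, τ < 0 → u τ = selfSimilarCollapse (1 / (2 + ρ)) 0 V τ)
    (hp : ∀ τ : ℝ, τ < 0 → p τ = selfSimilarCollapsePressure (1 / (2 + ρ)) 0 P τ)
    (hV : ContDiff ℝ 1 V)
    (hnt : ¬ (uncurry u =ᵐ[volume.restrict (Iio (0 : ℝ) ×ˢ (univ : Set (EuclideanSpace ℝ (Fin 3))))] 0)) :
    (∫⁻ y, ‖curl V y‖ₑ) = ∞ ∨ (∫⁻ y, ‖curl V y‖ₑ ^ 2) = ∞ := by
  by_contra h
  push Not at h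
  obtain ⟨h1, h2⟩ := h
  have hcont : Continuous (curl V) := by
    have e : curl V = fun y => curlCLM (fderiv ℝ V y) := rfl
    rw [e]
    exact curlCLM.continuous.comp (hV.continuous_fderiv one_ne_zero)
  have hmeas : AEStronglyMeasurable (curl V) volume := hcont.aestronglyMeasurable
  refine curl_not_integrable_and_memLp_two hρ hρ2 hsw hH hgauge hu hp hV hnt ⟨⟨hmeas, h1.lt_top⟩, ?_⟩
  refine ⟨hmeas, ?_⟩
  rw [eLpNorm_eq_lintegral_rpow_enorm_toReal two_ne_zero ENNReal.ofNat_ne_top]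
  refine ENNReal.rpow_lt_top_of_nonneg (by positivity) ?_
  have e2 : (fun y => ‖curl V y‖ₑ ^ ((2 : ℝ≥0∞).toReal)) = fun y => ‖curl V y‖ₑ ^ 2 := by
    funext y
    rw [ENNReal.toReal_ofNat]
    exact ENNReal.rpow_ofNat _ 2
  rw [e2]
  exact h2

end Summit.NavierStokesRegularity.NavierStokesRegularity.Theorems.PowerGaugeEulerLiouville.NeedleDigest

end
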